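import Mathlib.Algebra.Order.Archimedean.Basic
import Literature.AlgebraicGeometry.Frobenioids.MonoidRealification
import Literature.AlgebraicGeometry.Frobenioids.Factorization
import HarnessLib

/-!
# Frobenioids I, §0: roots in `N ⊗ ℝ_{≥0}`; the completion is perfect; the archimedean property

Mochizuki, *The geometry of Frobenioids I*, Kyushu J. Math. **62** (2008), §0 "Numbers"/"Monoids",
kurims pp. 10–12 [cite: MochizukiFrdI2008, §0 p.10].  Elementary facts about the completion
`N ⊗ ℝ_{≥0} = Hom(N^∨, ℝ_{≥0})` (`MonoidRealification.lean`) used in the proof that the realification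
`M^rlf` of a perf-factorial monoid is perf-factorial (Def. 2.4 (i), p. 48): `N ⊗ ℝ_{≥0}` has unique
`n`-th roots (`Realification.root`), hence is perfect with injective power maps and no torsion; and in
an `ℝ`-monoprime monoid every element is `≼` every non-trivial element (archimedean property of
`ℝ_{≥0}`, `exists_dvd_pow_of_isRMonoprime`).  No statement of the paper is strengthened.
-/

noncomputable section

namespace Literature.AlgebraicGeometry.Frobenioids

open Function

universe u

/-! ### Roots in `N ⊗ ℝ_{≥0}`; `N ⊗ ℝ_{≥0}` is perfect -/

section RealificationRoots

variable {N : Type u} [CommMonoid N]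

/-- A homomorphism `N^∨ → ℝ_{≥0}` viewed as an element of `N ⊗ ℝ_{≥0}` (inverse of `toHom`).
[cite: MochizukiFrdI2008, §0 p.10] -/
def Realification.ofHom (φ : RDual N →* Multiplicative NNReal) : Realification N := φ

/-- `toHom (ofHom φ) = φ`. [cite: MochizukiFrdI2008, §0 p.10] -/
@[simp] theorem Realification.toHom_ofHom (φ : RDual N →* Multiplicative NNReal) :
    (Realification.ofHom φ).toHom = φ := rfl

/-- `toHom` of a power. [cite: MochizukiFrdI2008, §0 p.10] -/
@[simp] theorem Realification.toHom_pow (s : Realification N) (n : ℕ) : (s ^ n).toHom = s.toHom ^ n := rfl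

/-- The `n`-th root in `N ⊗ ℝ_{≥0} = Hom(N^∨, ℝ_{≥0})`: divide all values by `n`.
[cite: MochizukiFrdI2008, §0 p.10] -/
def Realification.root (n : ℕ+) : Realification N →* Realification N where
  toFun s := Realification.ofHom
    { toFun := fun f => Multiplicative.ofAdd (Multiplicative.toAdd (s.toHom f) / (n : NNReal))
      map_one' := by rw [map_one, toAdd_one, zero_div, ofAdd_zero]
      map_mul' := fun f g => by rw [map_mul, toAdd_mul, add_div, ofAdd_add] }
  map_one' := Realification.ext' fun f => by
    simp only [Realification.toHom_ofHom, MonoidHom.coe_mk, OneHom.coe_mk, Realification.toHom_one,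
      MonoidHom.one_apply, toAdd_one, zero_div, ofAdd_zero]
  map_mul' s t := Realification.ext' fun f => by
    simp only [Realification.toHom_ofHom, MonoidHom.coe_mk, OneHom.coe_mk, Realification.toHom_mul,
      MonoidHom.mul_apply, toAdd_mul, add_div, ofAdd_add]

/-- `toHom (root n s) f = s(f)/n`. [cite: MochizukiFrdI2008, §0 p.10] -/
theorem Realification.toHom_root (n : ℕ+) (s : Realification N) (f : RDual N) :
    (Realification.root n s).toHom f =
      Multiplicative.ofAdd (Multiplicative.toAdd (s.toHom f) / (n : NNReal)) := rfl

/-- `(root n s)^n = s`. [cite: MochizukiFrdI2008, §0 p.10] -/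
theorem Realification.root_pow (n : ℕ+) (s : Realification N) : Realification.root n s ^ (n : ℕ) = s := by
  have hn : ((n : ℕ) : NNReal) ≠ 0 := Nat.cast_ne_zero.mpr n.pos.ne'
  refine Realification.ext' fun f => ?_
  rw [Realification.toHom_pow, MonoidHom.pow_apply, Realification.toHom_root, ← ofAdd_nsmul,
    nsmul_eq_mul, mul_div_cancel₀ _ hn, ofAdd_toAdd]

/-- `root n (s^n) = s`. [cite: MochizukiFrdI2008, §0 p.10] -/
theorem Realification.root_pow_self (n : ℕ+) (s : Realification N) :
    Realification.root n (s ^ (n : ℕ)) = s := by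
  have hn : ((n : ℕ) : NNReal) ≠ 0 := Nat.cast_ne_zero.mpr n.pos.ne'
  refine Realification.ext' fun f => ?_
  rw [Realification.toHom_root, Realification.toHom_pow, MonoidHom.pow_apply, toAdd_pow, nsmul_eq_mul,
    mul_div_cancel_left₀ _ hn, ofAdd_toAdd]

/-- **`N ⊗ ℝ_{≥0}` is perfect.** [cite: MochizukiFrdI2008, §0 p.11] -/
theorem isPerfect_realification : IsPerfect (Realification N) := by
  refine ⟨fun n hn => ⟨fun s t hst => ?_, fun t => ⟨Realification.root ⟨n, hn⟩ t, ?_⟩⟩⟩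
  · have := congrArg (Realification.root ⟨n, hn⟩) hst
    dsimp only at this
    have e1 : Realification.root ⟨n, hn⟩ (s ^ n) = s := Realification.root_pow_self ⟨n, hn⟩ s
    have e2 : Realification.root ⟨n, hn⟩ (t ^ n) = t := Realification.root_pow_self ⟨n, hn⟩ t
    rwa [e1, e2] at this
  · exact Realification.root_pow ⟨n, hn⟩ t

/-- The `n`-th power maps of `N ⊗ ℝ_{≥0}` are injective. [cite: MochizukiFrdI2008, §0 p.11] -/
theorem Realification.pow_injective {n : ℕ} (hn : 0 < n) : Injective fun s : Realification N => s ^ n :=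
  (isPerfect_realification.1 n hn).1

/-- `root n s = 1 ↔ s = 1`. [cite: MochizukiFrdI2008, §0 p.10] -/
theorem Realification.root_eq_one_iff (n : ℕ+) (s : Realification N) : Realification.root n s = 1 ↔ s = 1 := by
  constructor
  · intro h
    rw [← Realification.root_pow n s, h, one_pow]
  · intro h
    rw [h, map_one]

/-- `s ^ n = 1 ↔ s = 1` for `n ≥ 1` (`N ⊗ ℝ_{≥0}` is sharp, hence torsion-free).
[cite: MochizukiFrdI2008, §0 p.11] -/
theorem Realification.pow_eq_one_iff {n : ℕ} (hn : 0 < n) (s : Realification N) : s ^ n = 1 ↔ s = 1 :=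
  ⟨fun h => (isSharp_realification N).isTorsionFree.1 s n hn h, fun h => by rw [h, one_pow]⟩

/-- In an `ℝ`-monoprime monoid every element is `≼` every non-trivial element (archimedean property
of `ℝ_{≥0}`): `∃ n ≥ 1, x ≤ n · y`. [cite: MochizukiFrdI2008, §0 p.12] -/
theorem exists_dvd_pow_of_isRMonoprime (hN : IsRMonoprime N) (x y : N) (hy : y ≠ 1) :
    ∃ n : ℕ, 0 < n ∧ x ∣ y ^ n := by
  obtain ⟨⟨e⟩⟩ := hN
  have hy' : 0 < Multiplicative.toAdd (e y) := by
    rw [pos_iff_ne_zero]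
    intro h0
    apply hy
    apply e.injective
    rw [map_one]
    exact Multiplicative.toAdd.injective h0
  obtain ⟨n, hn⟩ := Archimedean.arch (Multiplicative.toAdd (e x)) hy'
  refine ⟨n + 1, Nat.succ_pos n, ?_⟩
  rw [← map_dvd_iff e, map_pow]
  have hle : Multiplicative.toAdd (e x) ≤ Multiplicative.toAdd (e y ^ (n + 1)) := by
    rw [toAdd_pow]
    rw [succ_nsmul]
    exact hn.trans le_self_add
  obtain ⟨c, hc⟩ := exists_add_of_le hle
  exact ⟨Multiplicative.ofAdd c, Multiplicative.toAdd.injective (by rw [toAdd_mul, toAdd_ofAdd, hc])⟩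

end RealificationRoots

end Literature.AlgebraicGeometry.Frobenioids
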